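import Literature.NumberTheory.EllipticCurves.FormalGroupVerschiebungHasseZeroProofs
import Literature.NumberTheory.EllipticCurves.SupersingularDivisionPolynomialProofs
import Literature.NumberTheory.EllipticCurves.IwasawaSelmerSupersingularLocalProofs
import HarnessLib

/-!
# Height `≥ 2` of the formal group at a place of good SUPERSINGULAR reduction: the coefficients of
# `[p]` of the local minimal integral model below degree `p²` (indeed all with `p² ∤ n`) lie in `𝔪_v`
# (Silverman AEC IV.7.5 / V.3.1(a) with V.4.1(a); Serre 1967 §5 Lemme 3 hypothesis; proofs only)

`Proofs`-style file (THEOREMS ONLY: no definition, no named fact, no instance), topic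
`NumberTheory/EllipticCurves`; sequel of `FormalGroupVerschiebungHasseZeroProofs` (Lazard's lemma for
the Verschiebung: `A_p = 0 ⇒ [p] ∈ S⟦t^{p²}⟧` over every ring of odd prime characteristic `p`).

* `hasseCoeff_eq_zero_of_hasseCoeff_prime_pow_eq_zero` — over a reduced ring of odd prime
  characteristic `p`, `A_{p^r} = 0 ⇒ A_p = 0` (`r ≥ 1`; converse of the tree's
  `hasseCoeff_prime_pow_eq_zero`, from `A_{p^{s+1}} = A_{p^s}·A_p^{p^s}`,
  `hasseCoeff_prime_pow_succ`; Silverman AEC V.4.1, proof of (b)).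
* `hasseCoeff_eq_zero_of_dvd_card_add_one_sub_natCard_point` — **supersingular ⇒ Hasse invariant
  zero** over a finite field `k` of odd characteristic `p`: `p ∣ #k + 1 − #E(k)` (i.e. `p ∣ a_k`) gives
  `A_p(E) = 0` (`a = A_q` in `k`, AEC V.4.1(a), tree `hasseCoeffAt_card_eq_zero_of_dvd`, and the
  previous item).
* `coeff_formalMul_prime_eq_zero_of_dvd_card_add_one_sub_natCard_point` — hence over such `k`,
  `[tⁿ][p]_E = 0` for `p² ∤ n` (height `≥ 2`, AEC IV.7.5 / V.3.1(a)).
* `coeff_formalMul_localMinimalIntegralModel_mem_maximalIdeal` — **the number-field form, in the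
  tree's reduction vocabulary**: for `W/K` (`K` a number field), a finite place `v ∋ p` (`p` odd) with
  `W.HasGoodReductionAt v` and `¬ W.HasUnitRootAt v` (good SUPERSINGULAR reduction: `p ∣ a_v`), every
  coefficient `aₙ` of `[p](t) = Σ aₙ tⁿ` of the local minimal integral model
  `W.localMinimalIntegralModel v` over `𝒪_{K_v}` with `p² ∤ n` lies in the maximal ideal `𝔪_v`. This
  is the hypothesis «`aₙ ∈ 𝔪` pour `n < p^h`» (`h = 2`) of Serre, Driebergen 1966, §5 Lemme 3 (the
  ramification of the `pⁿ`-torsion of a one-dimensional formal group of height `h`), at every place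
  of good supersingular reduction of a number field — with no restriction on the ramification of
  `K_v/ℚ_p` (the tree's earlier supersingular valuation files `SupersingularTorsionValuation*`,
  `SerreOpenImageSupersingular*` work at an absolutely unramified place and at level `1`).

What is NOT here: the valuation estimates for `pⁿ`-torsion themselves (Serre's iteration
`v([p]x) ≥ min(p² v(x), v(x) + v(𝔪))`, which needs the evaluation of `[p]` at points of `E₁`), the
exact height (`[t^{p²}][p] ∈ 𝒪_v^×`), `p = 2`.

## References

* J. H. Silverman, *The Arithmetic of Elliptic Curves*, 2nd ed., GTM 106 (2009), IV.7.5, V.3.1(a),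
  V.4.1(a) and its proof, VII.2. [SilvermanAEC2009]
* J.-P. Serre, *Sur les groupes de Galois attachés aux groupes p-divisibles*, Proc. Conf. Local Fields
  (Driebergen 1966), Springer 1967, §5 Lemme 3. [Serre1967GroupesPDivisibles]
-/

noncomputable section

open scoped Classical

namespace WeierstrassCurve

open PowerSeries Literature.NumberTheory.EllipticCurves NumberField IsDedekindDomain IsLocalRing

/-! ### `A_{p^r} = 0 ⇒ A_p = 0` -/

section CharP

variable {R : Type*} [CommRing R] [NoZeroDivisors R] (W : WeierstrassCurve R) (p : ℕ)
  [hp : Fact p.Prime] [CharP R p]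

/-- **`A_{p^r} = 0 ⇒ A_p = 0`** (`r ≥ 1`) over a ring of odd prime characteristic `p` without zero
divisors: `A_{p^{s+1}} = A_{p^s} · A_p^{p^s}` (`hasseCoeff_prime_pow_succ`), so a vanishing
`A_{p^{s+1}}` forces `A_{p^s} = 0` or `A_p = 0`, and induction ends at `A_{p^1} = A_p`.
[cite: SilvermanAEC2009, V.4.1 (proof)] -/
theorem hasseCoeff_eq_zero_of_hasseCoeff_prime_pow_eq_zero (hp2 : p ≠ 2) {r : ℕ} (hr : 0 < r)
    (hA : W.hasseCoeff (p ^ r) = 0) : W.hasseCoeff p = 0 := by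
  obtain ⟨s, rfl⟩ : ∃ s, r = s + 1 := ⟨r - 1, by omega⟩
  induction s with
  | zero => rwa [zero_add, pow_one] at hA
  | succ s ih =>
    rw [hasseCoeff_prime_pow_succ W p hp2 (s + 1)] at hA
    rcases mul_eq_zero.mp hA with h | h
    · exact ih (Nat.succ_pos s) h
    · exact (pow_eq_zero_iff (pow_ne_zero _ hp.out.ne_zero)).mp h

end CharP

/-! ### Finite fields: supersingular ⇒ `A_p = 0` ⇒ `[p] ∈ k⟦t^{p²}⟧` -/

section Finite

variable {k : Type*} [Field k] [Fintype k] (E : WeierstrassCurve k) (p : ℕ) [hp : Fact p.Prime]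
  [CharP k p]

/-- **Supersingular ⇒ Hasse invariant zero** over a finite field `k` of odd characteristic `p`: if
`p ∣ #k + 1 − #E(k)` (`p ∣ a_k`) for an elliptic `E/k`, then `A_p(E) = 0` — Silverman AEC V.4.1(a)
`a = A_q` in `k` (tree: `hasseCoeffAt_card_eq_zero_of_dvd`), `q = p^f`, and `A_q = 0 ⇒ A_p = 0`.
[cite: SilvermanAEC2009, V.4.1] -/
theorem hasseCoeff_eq_zero_of_dvd_card_add_one_sub_natCard_point [E.IsElliptic] (hp2 : p ≠ 2)
    (hss : (p : ℤ) ∣ (Fintype.card k : ℤ) + 1 - Nat.card E.toAffine.Point) :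
    E.hasseCoeff p = 0 := by
  have h2 : ringChar k ≠ 2 := by rw [ringChar.eq k p]; exact hp2
  have hq : E.hasseCoeffAt (Fintype.card k) = 0 := E.hasseCoeffAt_card_eq_zero_of_dvd h2 hss
  obtain ⟨n, -, hn⟩ := FiniteField.card k p
  rw [hn] at hq
  exact E.hasseCoeff_eq_zero_of_hasseCoeff_prime_pow_eq_zero p hp2 n.pos hq

/-- **Height `≥ 2` at a supersingular elliptic curve over a finite field** of odd characteristic
`p`: if `p ∣ #k + 1 − #E(k)` then `[tⁿ][p]_E = 0` for every `n` with `p² ∤ n`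
(`[p](t) = h(t^{p²})`). [cite: SilvermanAEC2009, IV.7.5] -/
theorem coeff_formalMul_prime_eq_zero_of_dvd_card_add_one_sub_natCard_point [E.IsElliptic]
    (hp2 : p ≠ 2) (hss : (p : ℤ) ∣ (Fintype.card k : ℤ) + 1 - Nat.card E.toAffine.Point)
    {n : ℕ} (hn : ¬ p ^ 2 ∣ n) : PowerSeries.coeff n (E.formalMul p) = 0 :=
  E.coeff_formalMul_prime_eq_zero_of_hasseCoeff_eq_zero p hp2
    (E.hasseCoeff_eq_zero_of_dvd_card_add_one_sub_natCard_point p hp2 hss) hn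

end Finite

/-! ### Number fields: the local minimal integral model at a place of good supersingular reduction -/

section NumberField

variable {K : Type*} [Field K] [NumberField K] (W : WeierstrassCurve K)
  (v : HeightOneSpectrum (𝓞 K)) {p : ℕ} [hp : Fact p.Prime]

/-- The reduction of the chosen local minimal model is the base change of the local minimal integral
model to the residue field (unfolding Mathlib's `WeierstrassCurve.reduction`). [folklore] -/
private theorem reduction_localMinimalModel_eq :
    (W.localMinimalModel v).reduction (v.adicCompletionIntegers K) =
      (W.localMinimalIntegralModel v).map (residue (v.adicCompletionIntegers K)) :=
  rfl

/-- **Serre's hypothesis «`aₙ ∈ 𝔪` for `n < p²`» at a place of good SUPERSINGULAR reduction of a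
number field.** Let `W/K` be a Weierstrass equation over a number field, `v` a finite place of
residue characteristic `p` (odd) at which `W` has good reduction (`W.HasGoodReductionAt v`) with
NON-ordinary reduction (`¬ W.HasUnitRootAt v`, i.e. `p ∣ a_v = q_v + 1 − #Ẽ(k_v)`). Then every
coefficient of the multiplication-by-`p` series `[p](t) = Σ aₙ tⁿ` of the local minimal integral model
`W.localMinimalIntegralModel v` over `𝒪_{K_v}` with `p² ∤ n` lies in the maximal ideal `𝔪_v` — the
formal group of `E/K_v` has height `≥ 2` (Silverman AEC IV.7.5 / V.3.1(a)), in the form used by Serre's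
ramification estimate for `pⁿ`-torsion (Driebergen 1966, §5 Lemme 3 with `h = 2`), at ANY
ramification index of `K_v/ℚ_p`. [cite: Serre1967GroupesPDivisibles, §5 Lemme 3]
[cite: SilvermanAEC2009, IV.7.5] -/
theorem coeff_formalMul_localMinimalIntegralModel_mem_maximalIdeal (hp2 : p ≠ 2)
    (hv : (p : 𝓞 K) ∈ v.asIdeal) (hgood : W.HasGoodReductionAt v) (hss : ¬ W.HasUnitRootAt v)
    {n : ℕ} (hn : ¬ p ^ 2 ∣ n) :
    PowerSeries.coeff n ((W.localMinimalIntegralModel v).formalMul p) ∈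
      maximalIdeal (v.adicCompletionIntegers K) := by
  set O := v.adicCompletionIntegers K with hO
  set k := ResidueField O with hk
  set Ered := (W.localMinimalModel v).reduction O with hE
  -- the residue field: finite of characteristic `p`
  letI : Fintype k := Fintype.ofFinite k
  have hchar : ringChar k = p := ringChar_residueField_eq v hp.out hv
  haveI : CharP k p := ringChar.of_eq hchar
  -- the reduction is an elliptic curve (good reduction), supersingular (`¬` unit root)
  haveI : Ered.IsElliptic := (hasGoodReduction_iff_isElliptic_reduction (R := O)).mp hgood
  have hdvd : (p : ℤ) ∣ (Fintype.card k : ℤ) + 1 - Nat.card Ered.toAffine.Point := by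
    have h := hss
    rw [hasUnitRootAt_iff, not_not, hchar, Nat.card_eq_fintype_card] at h
    exact h
  -- height ≥ 2 for the reduction, lifted to `𝒪_{K_v}`
  have hzero : PowerSeries.coeff n (Ered.formalMul p) = 0 :=
    Ered.coeff_formalMul_prime_eq_zero_of_dvd_card_add_one_sub_natCard_point p hp2 hdvd hn
  rw [← residue_eq_zero_iff, ← PowerSeries.coeff_map, map_formalMul,
    ← reduction_localMinimalModel_eq W v]
  exact hzero

end NumberField

end WeierstrassCurve

end
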